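import Mathlib.Data.ENNReal.Inv
import Mathlib.Tactic.Ring
import HarnessLib

/-!
# F0 · P3c · line LH6 «StCharTS» — WIF antecedent, ELLIPTIC half: brick (C8b-abs) «TUBE JACOBIAN BOOKKEEPING» — the `ℝ≥0∞` junction that turns the chart
# identities (C4 ×2), the quotient normalisation (Q1), the tube identity (C8a) and the two index identities (Q7) into the socket equation

Cell `pub/hodgecm-mathlib`, crux H413 = `stmt-HodgeConjecture-24833` (lane `--supports … --as helper`); seat LH5-p02 (g6); ROAD «JAC-ELL» v1
(`F0/P3c/LH5/LH5-p02/g6/ROAD-JAC-ELL.v1.LH5p02g6.md` §2 steps (1)–(6)).  THEOREMS ONLY; Mathlib only.  Count-neutral.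

WHAT.  ROAD v1 §2 computes, for a coset-shaped `V` near a regular `t₀` of a compact Cartan `T`:
`ν(Φ(A₀ × V)) = χ·μ(𝔪_0 ⊕ 𝔱_j) ∕ κ` (C8a with the `𝔲`-chart constant `κ`: `μ B = κ · ν(c B)`), `μ₀(A₀) = ν K′ ∕ tm K_T` (Q1), `ν K′ = μ(𝔪_0 ⊕ 𝔱_0) ∕ κ` (C4 for `𝔲`),
`tm K_T = μ_𝔱(𝔱_0) ∕ κ_T`, `tm V = μ_𝔱(𝔱_j) ∕ κ_T` (C4 for `𝔱`), and `μ(𝔪_0 ⊕ 𝔱_0) = n·μ(𝔪_0 ⊕ 𝔱_j)`, `μ_𝔱(𝔱_0) = n·μ_𝔱(𝔱_j)` (Q7, `n = [𝔱_0 : 𝔱_j]`).  This file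
proves, ONCE, the resulting `ℝ≥0∞` identity **`ν(Φ(A₀ × V)) = μ₀(A₀) · χ · tm V`** from these seven equations and the finiteness ∕ non-vanishing side conditions
(`tube_jacobian_bookkeeping`, `tube_jacobian_bookkeeping'`), so that the model file C8b only discharges hypotheses and never manipulates `ℝ≥0∞` quotients.

HONEST LABEL: HC_CM is proved only modulo the 7 printed citations (2 remaining named inputs: hLiu418 = `stmt-HodgeConjecture-24832`, h413 =
`stmt-HodgeConjecture-24833`) until rung 0 closes; this file closes no organ.

## References
* [HarishChandra1970] Harish-Chandra (notes by G. van Dijk), *Harmonic Analysis on Reductive p-adic Groups*, LNM 162 (1970), Lemma 22 (the identity assembled). Context locator.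
-/

set_option autoImplicit false
set_option linter.dupNamespace false

open scoped ENNReal

namespace Summit.HodgeConjecture.HodgeConjecture.Cruxes.H413.F0P3cStCharTSTubeJacobianBookkeeping

/-- **TUBE JACOBIAN BOOKKEEPING (multiplicative form, no divisions).**  Seven products in, one product out:
if `κ·x = χ·a_j` (C8a), `νK′ = m₀·tK` (Q1), `a_0 = κ·νK′`, `b_0 = κT·tK`, `b_j' = κT·tV`
(chart constants), `a_0 = n·a_j`, `b_0 = n·b_j`, `b_j' = b_j` (index ∕ translation), with `κ, n, b_j` finite and non-zero, then `x = m₀·(χ·tV)`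
(multiply by `κ·n·b_j` and cancel — no division is ever formed).
[cite: HarishChandra1970, Lemma 22] -/
theorem tube_jacobian_bookkeeping {x χ κ κT m₀ tK tV νK' a₀ aⱼ b₀ bⱼ bⱼ' n : ℝ≥0∞}
    (hκ : κ ≠ 0) (hκ' : κ ≠ ∞) (hn : n ≠ 0) (hn' : n ≠ ∞) (hbⱼ : bⱼ ≠ 0) (hbⱼ' : bⱼ ≠ ∞)
    (hC8a : κ * x = χ * aⱼ)            -- tube measure in the chart
    (hQ1 : νK' = m₀ * tK)             -- quotient normalisation
    (hK' : a₀ = κ * νK')               -- `𝔲`-chart constant on the window `K′`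
    (hT0 : b₀ = κT * tK)               -- `𝔱`-chart constant on `K_T`
    (hTV : bⱼ' = κT * tV)              -- `𝔱`-chart constant on `V`
    (hQ7 : a₀ = n * aⱼ)                -- split-box index identity in `𝔲`
    (hidx : b₀ = n * bⱼ)               -- index identity in `𝔱`
    (htr : bⱼ' = bⱼ) :                 -- translation invariance in `𝔱`
    x = m₀ * (χ * tV) := by
  -- `κ · m₀ · tK = n · aⱼ` and `κT · tK = n · bⱼ`, `κT · tV = bⱼ`
  have hkm : κ * (m₀ * tK) = n * aⱼ := by rw [← hQ1, ← hK', hQ7]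
  have hTK : κT * tK = n * bⱼ := by rw [← hT0, hidx]
  have hTV' : κT * tV = bⱼ := by rw [← hTV, htr]
  -- multiply the claim by the finite non-zero constant `κ · (n · bⱼ)` and compute both sides
  have key : κ * (n * bⱼ) * x = κ * (n * bⱼ) * (m₀ * (χ * tV)) := by
    calc κ * (n * bⱼ) * x = n * bⱼ * (κ * x) := by ring
      _ = n * bⱼ * (χ * aⱼ) := by rw [hC8a]
      _ = χ * (n * aⱼ) * bⱼ := by ring
      _ = χ * (κ * (m₀ * tK)) * (κT * tV) := by rw [hkm, hTV']
      _ = χ * κ * m₀ * tV * (κT * tK) := by ring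
      _ = χ * κ * m₀ * tV * (n * bⱼ) := by rw [hTK]
      _ = κ * (n * bⱼ) * (m₀ * (χ * tV)) := by ring
  have h0 : κ * (n * bⱼ) ≠ 0 := mul_ne_zero hκ (mul_ne_zero hn hbⱼ)
  have htop : κ * (n * bⱼ) ≠ ∞ := ENNReal.mul_ne_top hκ' (ENNReal.mul_ne_top hn' hbⱼ')
  exact (ENNReal.mul_right_inj h0 htop).1 key

/-- **TUBE JACOBIAN BOOKKEEPING, road form.**  The same with the road's letters: `x = ν(Φ(A₀ × V))`, `aⱼ = μ(𝔪_0 ⊕ 𝔱_j)`, `a₀ = μ(𝔪_0 ⊕ 𝔱_0)`,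
`bⱼ = μ_𝔱(𝔱_j)`, `b₀ = μ_𝔱(𝔱_0)`, `νK′ = ν(c(𝔪_0 ⊕ 𝔱_0))`, `tK = tm(K_T)`, `tV = tm(V)`, `m₀ = μ₀(A₀)`, `χ = (𝔇.DG t₀)²`; conclusion in the socket's
order `x = m₀ * (χ * tV)` = `μ₀ A₀ * ∫⁻_V D dtm` once `D ≡ χ` on `V`. [cite: HarishChandra1970, Lemma 22] -/
theorem tube_jacobian_bookkeeping' {x χ κ κT m₀ tK tV a₀ aⱼ b₀ bⱼ n : ℝ≥0∞}
    (hκ : κ ≠ 0) (hκ' : κ ≠ ∞) (hn : n ≠ 0) (hn' : n ≠ ∞) (hbⱼ : bⱼ ≠ 0) (hbⱼ' : bⱼ ≠ ∞)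
    (hC8a : κ * x = χ * aⱼ) (hQ1 : κ * (m₀ * tK) = a₀) (hT0 : b₀ = κT * tK) (hTV : bⱼ = κT * tV)
    (hQ7 : a₀ = n * aⱼ) (hidx : b₀ = n * bⱼ) :
    x = m₀ * (χ * tV) :=
  tube_jacobian_bookkeeping (νK' := m₀ * tK) (bⱼ' := bⱼ) hκ hκ' hn hn' hbⱼ hbⱼ' hC8a rfl hQ1.symm hT0 hTV hQ7 hidx rfl

end Summit.HodgeConjecture.HodgeConjecture.Cruxes.H413.F0P3cStCharTSTubeJacobianBookkeeping
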